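import Literature.AlgebraicGeometry.Modules.BoxTensorComplexBaseChange
import Literature.AlgebraicGeometry.Modules.BoxTensorPullback
import HarnessLib

/-!
# Two-sided base change and two-sided twist of the external tensor product of complexes:
# `(u^*•R) ⊠_{p',q'} (v^*•S) ≅ g^*•(R ⊠_{p,q} S)` and `(N₁ ⊗ •u^*•R) ⊠ (N₂ ⊗ •v^*•S) ≅ ((N₁ ⊠ N₂) ⊗ –)•g^*•(R ⊠ S)`

Layer `Literature/AlgebraicGeometry/Modules`; chain-level sequel to `Modules/BoxTensorComplexBaseChange` (ONE-sided base change `g ≫ q = q'`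
and the twist of the SECOND factor) and `Modules/BoxTensorPullback` (the two-sided TERM isomorphism `pullbackBoxTensorIso`). For a map of spans
`g ≫ p = p' ≫ u`, `g ≫ q = q' ≫ v` (`p : Z ⟶ X`, `q : Z ⟶ Y`, `p' : Z' ⟶ X'`, `q' : Z' ⟶ Y'`, `g : Z' ⟶ Z`, `u : X' ⟶ X`, `v : Y' ⟶ Y`), cochain
complexes `R` on `X`, `S` on `Y` with FINITE LOCALLY FREE TERMS, and finite locally free `N₁` on `X'`, `N₂` on `Y'`, this file PROVES (0 named
facts, no instances):

* §1 terms: naturality of `pullbackBoxTensorIso` in maps of vector bundles (`pullbackBoxTensorIso_hom_naturality`, and the two one-variable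
  forms on inverses consumed by `mapBifunctorIsoOfComponents`); the twist of the FIRST factor **`boxTensorTwistLeftIso : (N ⊗ E) ⊠ F ≅ p^*N ⊗ (E ⊠ F)`**
  (`pullbackTensorIso p` + associator — no symmetry needed) with its naturalities;
* §2 complexes: **`pullbackBoxTensorComplexIso₂ : (u^*•R) ⊠_{p',q'} (v^*•S) ≅ g^*•(R ⊠_{p,q} S)`**,
  **`boxTensorComplexTwistLeftIso : (N ⊗ •R) ⊠ S ≅ (p^*N ⊗ –)•(R ⊠ S)`**, and the composite used by the Hodge road
  **`boxTensorComplexTwoSidedIso : (N₁ ⊗ •u^*•R) ⊠_{p',q'} (N₂ ⊗ •v^*•S) ≅ ((N₁ ⊠_{p',q'} N₂) ⊗ –)•(g^*•(R ⊠_{p,q} S))`**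
  (left twist, right twist `boxTensorComplexTwistIso`, two-sided base change, then the associator `(q'^*N₂ ⊗ –) ⋙ (p'^*N₁ ⊗ –) ≅ ((N₁ ⊠ N₂) ⊗ –)`
  termwise).

Here `Φ•K := (Φ.mapHomologicalComplex (ComplexShape.up ℤ)).obj K`. Typed for the cell `pub-hodge-ring2` (crux 26512, placement P1 of the `e₂`
wiring: with `g = π₁ × π₂ : J × J → J∕G₁ × J∕G₂`, `u = π₁`, `v = π₂`, `N₁ = N₂ = 𝒪(Θ)`, it identifies the box of the twisted pulled-back resolutions with
`[Θ ⊠ Θ] ⊗ (π₁ × π₂)^*(R ⊠ S)`; a research route conditional on HC_CM, not a corollary — nothing in this file refers to it).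

## References

* The Stacks Project, Tag 01CA (Lemma 17.16.1 associator, Lemma 17.16.4 pull-back is monoidal), Tag 0FXX (`K ⊠ M`), Tag 012Z (total complex). [StacksProject]
* U. Görtz, T. Wedhorn, *Algebraic Geometry II* (2023), (22.25) before Cor. 22.110 (p. 286). [GortzWedhorn2023]
* C. A. Weibel, *An introduction to homological algebra* (1994), §1.2, 1.2.6 and §2.6. [Weibel1994]
-/

noncomputable section

-- `TopCat.Presheaf`/`Scheme.Modules` are not reducible (as in Mathlib's `AlgebraicGeometry/Modules/Sheaf.lean`).
set_option backward.isDefEq.respectTransparency false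

open CategoryTheory CategoryTheory.Limits AlgebraicGeometry
open AlgebraicGeometry.Scheme.Modules

universe u

namespace Literature.AlgebraicGeometry.Modules

open Literature.AlgebraicGeometry.Motives Literature.Algebra.Homology

variable {X X' Y Y' Z Z' : Scheme.{u}} {p : Z ⟶ X} {q : Z ⟶ Y} {p' : Z' ⟶ X'} {q' : Z' ⟶ Y'} {g : Z' ⟶ Z}
  {u : X' ⟶ X} {v : Y' ⟶ Y}

/-! ### §1 Term isomorphisms and their naturality -/

section Terms

/-- **Naturality of the two-sided base change `pullbackBoxTensorIso`** in maps of vector bundles `φ : E → E'`, `ψ : F → F'`: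
`g^*(φ ⊠ ψ) ≫ iso = iso ≫ (u^*φ ⊠ v^*ψ)`. [cite: StacksProject, Tag 01CA (Lemma 17.16.4)] -/
theorem pullbackBoxTensorIso_hom_naturality (hp : g ≫ p = p' ≫ u) (hq : g ≫ q = q' ≫ v) {E E' : X.Modules} {F F' : Y.Modules}
    (hE : IsFiniteLocallyFree E) (hE' : IsFiniteLocallyFree E') (hF : IsFiniteLocallyFree F) (hF' : IsFiniteLocallyFree F')
    (φ : E ⟶ E') (ψ : F ⟶ F') :
    (Scheme.Modules.pullback g).map (boxTensorMap p q φ ψ) ≫ (pullbackBoxTensorIso hp hq hE' hF').hom =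
      (pullbackBoxTensorIso hp hq hE hF).hom ≫
        boxTensorMap p' q' ((Scheme.Modules.pullback u).map φ) ((Scheme.Modules.pullback v).map ψ) := by
  rw [pullbackBoxTensorIso_hom, pullbackBoxTensorIso_hom, boxTensorMap, boxTensorMap, ← Category.assoc,
    pullbackTensorHom_naturality, Category.assoc, Category.assoc, ← tensorMap_comp, ← tensorMap_comp,
    pullbackSquareIso_hom_naturality hp, pullbackSquareIso_hom_naturality hq]

/-- `pullbackBoxTensorIso` against the first differential (`φ ⊠ 𝟙` on inverses). [cite: StacksProject, Tag 01CA (Lemma 17.16.4)] -/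
theorem pullbackBoxTensorIso_inv_naturality_left (hp : g ≫ p = p' ≫ u) (hq : g ≫ q = q' ≫ v) {E E' : X.Modules} {F : Y.Modules}
    (hE : IsFiniteLocallyFree E) (hE' : IsFiniteLocallyFree E') (hF : IsFiniteLocallyFree F) (φ : E ⟶ E') :
    tensorMap ((Scheme.Modules.pullback p').map ((Scheme.Modules.pullback u).map φ))
        (𝟙 ((Scheme.Modules.pullback q').obj ((Scheme.Modules.pullback v).obj F))) ≫ (pullbackBoxTensorIso hp hq hE' hF).inv =
      (pullbackBoxTensorIso hp hq hE hF).inv ≫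
        (Scheme.Modules.pullback g).map (tensorMap ((Scheme.Modules.pullback p).map φ) (𝟙 ((Scheme.Modules.pullback q).obj F))) := by
  have h := pullbackBoxTensorIso_hom_naturality hp hq hE hE' hF hF φ (𝟙 F)
  rw [boxTensorMap, boxTensorMap, CategoryTheory.Functor.map_id, CategoryTheory.Functor.map_id,
    CategoryTheory.Functor.map_id] at h
  rw [Iso.comp_inv_eq, Category.assoc, Iso.eq_inv_comp]
  exact h.symm

/-- `pullbackBoxTensorIso` against the second differential (`𝟙 ⊠ ψ` on inverses). [cite: StacksProject, Tag 01CA (Lemma 17.16.4)] -/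
theorem pullbackBoxTensorIso_inv_naturality_right (hp : g ≫ p = p' ≫ u) (hq : g ≫ q = q' ≫ v) {E : X.Modules} {F F' : Y.Modules}
    (hE : IsFiniteLocallyFree E) (hF : IsFiniteLocallyFree F) (hF' : IsFiniteLocallyFree F') (ψ : F ⟶ F') :
    tensorMap (𝟙 ((Scheme.Modules.pullback p').obj ((Scheme.Modules.pullback u).obj E)))
        ((Scheme.Modules.pullback q').map ((Scheme.Modules.pullback v).map ψ)) ≫ (pullbackBoxTensorIso hp hq hE hF').inv =
      (pullbackBoxTensorIso hp hq hE hF).inv ≫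
        (Scheme.Modules.pullback g).map (tensorMap (𝟙 ((Scheme.Modules.pullback p).obj E)) ((Scheme.Modules.pullback q).map ψ)) := by
  have h := pullbackBoxTensorIso_hom_naturality hp hq hE hE hF hF' (𝟙 E) ψ
  rw [boxTensorMap, boxTensorMap, CategoryTheory.Functor.map_id, CategoryTheory.Functor.map_id,
    CategoryTheory.Functor.map_id] at h
  rw [Iso.comp_inv_eq, Category.assoc, Iso.eq_inv_comp]
  exact h.symm

/-- **`(N ⊗ E) ⊠ F ≅ p^*N ⊗ (E ⊠ F)`** for finite locally free `N`, `E` on `X` and any `F` on `Y` (pull-back monoidal on vector bundles, then the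
associator): `p^*(N ⊗ E) ⊗ q^*F ≅ (p^*N ⊗ p^*E) ⊗ q^*F ≅ p^*N ⊗ (p^*E ⊗ q^*F)`. [cite: StacksProject, Tag 01CA (Lemma 17.16.1 and Lemma 17.16.4)] -/
def boxTensorTwistLeftIso (p : Z ⟶ X) (q : Z ⟶ Y) {N E : X.Modules} (hN : IsFiniteLocallyFree N) (hE : IsFiniteLocallyFree E)
    (F : Y.Modules) :
    boxTensor p q (tensorObj N E) F ≅ tensorObj ((Scheme.Modules.pullback p).obj N) (boxTensor p q E F) :=
  tensorMapIso (pullbackTensorIso p hN hE) (Iso.refl _) ≪≫ tensorAssoc _ _ _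

/-- Unfolding of `boxTensorTwistLeftIso`. [cite: StacksProject, Tag 01CA] -/
theorem boxTensorTwistLeftIso_hom (p : Z ⟶ X) (q : Z ⟶ Y) {N E : X.Modules} (hN : IsFiniteLocallyFree N) (hE : IsFiniteLocallyFree E)
    (F : Y.Modules) :
    (boxTensorTwistLeftIso p q hN hE F).hom = tensorMap (pullbackTensorHom p N E) (𝟙 _) ≫ (tensorAssoc _ _ _).hom := rfl

/-- **Naturality of `boxTensorTwistLeftIso`** in maps of vector bundles `φ : E → E'` and arbitrary `ψ : F → F'`:
`((N ⊗ φ) ⊠ ψ) ≫ iso = iso ≫ (p^*N ⊗ (φ ⊠ ψ))`. [cite: StacksProject, Tag 01CA (Lemma 17.16.1)] -/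
theorem boxTensorTwistLeftIso_hom_naturality (p : Z ⟶ X) (q : Z ⟶ Y) {N E E' : X.Modules} {F F' : Y.Modules}
    (hN : IsFiniteLocallyFree N) (hE : IsFiniteLocallyFree E) (hE' : IsFiniteLocallyFree E') (φ : E ⟶ E') (ψ : F ⟶ F') :
    boxTensorMap p q (tensorMap (𝟙 N) φ) ψ ≫ (boxTensorTwistLeftIso p q hN hE' F').hom =
      (boxTensorTwistLeftIso p q hN hE F).hom ≫ tensorMap (𝟙 _) (boxTensorMap p q φ ψ) := by
  have h1 : tensorMap ((Scheme.Modules.pullback p).map (tensorMap (𝟙 N) φ)) ((Scheme.Modules.pullback q).map ψ) ≫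
      tensorMap (pullbackTensorHom p N E') (𝟙 _) =
        tensorMap (pullbackTensorHom p N E) (𝟙 _) ≫
          tensorMap (tensorMap (𝟙 _) ((Scheme.Modules.pullback p).map φ)) ((Scheme.Modules.pullback q).map ψ) := by
    rw [← tensorMap_comp, ← tensorMap_comp, Category.comp_id, Category.id_comp, pullbackTensorHom_naturality,
      CategoryTheory.Functor.map_id]
  rw [boxTensorTwistLeftIso_hom, boxTensorTwistLeftIso_hom, boxTensorMap, boxTensorMap]
  simp only [Category.assoc]
  rw [reassoc_of% h1, tensorAssoc_naturality]

/-- `boxTensorTwistLeftIso` against the first differential (`(N ⊗ φ) ⊠ 𝟙`). [cite: StacksProject, Tag 01CA (Lemma 17.16.1)] -/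
theorem boxTensorTwistLeftIso_hom_naturality_left (p : Z ⟶ X) (q : Z ⟶ Y) {N E E' : X.Modules} (hN : IsFiniteLocallyFree N)
    (hE : IsFiniteLocallyFree E) (hE' : IsFiniteLocallyFree E') (φ : E ⟶ E') (F : Y.Modules) :
    tensorMap ((Scheme.Modules.pullback p).map (tensorMap (𝟙 N) φ)) (𝟙 ((Scheme.Modules.pullback q).obj F)) ≫
        (boxTensorTwistLeftIso p q hN hE' F).hom =
      (boxTensorTwistLeftIso p q hN hE F).hom ≫
        tensorMap (𝟙 ((Scheme.Modules.pullback p).obj N))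
          (tensorMap ((Scheme.Modules.pullback p).map φ) (𝟙 ((Scheme.Modules.pullback q).obj F))) := by
  have h := boxTensorTwistLeftIso_hom_naturality p q hN hE hE' φ (𝟙 F)
  rw [boxTensorMap, boxTensorMap, CategoryTheory.Functor.map_id] at h
  exact h

/-- `boxTensorTwistLeftIso` against the second differential (`𝟙 ⊠ ψ`). [cite: StacksProject, Tag 01CA (Lemma 17.16.1)] -/
theorem boxTensorTwistLeftIso_hom_naturality_right (p : Z ⟶ X) (q : Z ⟶ Y) {N E : X.Modules} {F F' : Y.Modules}
    (hN : IsFiniteLocallyFree N) (hE : IsFiniteLocallyFree E) (ψ : F ⟶ F') :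
    tensorMap (𝟙 ((Scheme.Modules.pullback p).obj (tensorObj N E))) ((Scheme.Modules.pullback q).map ψ) ≫
        (boxTensorTwistLeftIso p q hN hE F').hom =
      (boxTensorTwistLeftIso p q hN hE F).hom ≫
        tensorMap (𝟙 ((Scheme.Modules.pullback p).obj N))
          (tensorMap (𝟙 ((Scheme.Modules.pullback p).obj E)) ((Scheme.Modules.pullback q).map ψ)) := by
  have h := boxTensorTwistLeftIso_hom_naturality p q hN hE hE (𝟙 E) ψ
  rw [boxTensorMap, boxTensorMap, tensorMap_id, CategoryTheory.Functor.map_id, CategoryTheory.Functor.map_id] at h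
  exact h

end Terms

/-! ### §2 The isomorphisms of cochain complexes -/

section Complexes

variable (R : CochainComplex X.Modules ℤ) (S : CochainComplex Y.Modules ℤ)
  (hR : ∀ i, IsFiniteLocallyFree (R.X i)) (hS : ∀ j, IsFiniteLocallyFree (S.X j))

/-- **Two-sided base change of `R ⊠ S` along a map of spans, as cochain complexes**: for `g ≫ p = p' ≫ u`, `g ≫ q = q' ≫ v` and complexes
`R`, `S` of vector bundles, `(u^*•R) ⊠_{p',q'} (v^*•S) ≅ g^*•(R ⊠_{p,q} S)` (termwise `pullbackBoxTensorIso`; `g^*` is a left adjoint, so it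
preserves the coproducts of the total complex). [cite: StacksProject, Tag 01CA (Lemma 17.16.4) and Tag 0FXX] [cite: Weibel1994, §1.2, 1.2.6] -/
def pullbackBoxTensorComplexIso₂ (hp : g ≫ p = p' ≫ u) (hq : g ≫ q = q' ≫ v) :
    boxTensorComplex p' q' (((Scheme.Modules.pullback u).mapHomologicalComplex (ComplexShape.up ℤ)).obj R)
        (((Scheme.Modules.pullback v).mapHomologicalComplex (ComplexShape.up ℤ)).obj S) ≅
      ((Scheme.Modules.pullback g).mapHomologicalComplex (ComplexShape.up ℤ)).obj (boxTensorComplex p q R S) :=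
  haveI := preservesZeroMorphisms_boxTensorFunctor p q
  haveI := preservesZeroMorphisms_boxTensorFunctor_obj p q
  haveI := preservesZeroMorphisms_boxTensorFunctor p' q'
  haveI := preservesZeroMorphisms_boxTensorFunctor_obj p' q'
  mapBifunctorIsoOfComponents R S (((Scheme.Modules.pullback u).mapHomologicalComplex (ComplexShape.up ℤ)).obj R)
    (((Scheme.Modules.pullback v).mapHomologicalComplex (ComplexShape.up ℤ)).obj S)
    (boxTensorFunctor p q) (boxTensorFunctor p' q') (Scheme.Modules.pullback g)
    (fun i j => (pullbackBoxTensorIso hp hq (hR i) (hS j)).symm)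
    (fun i i' j => pullbackBoxTensorIso_inv_naturality_left hp hq (hR i) (hR i') (hS j) (R.d i i'))
    (fun i j j' => pullbackBoxTensorIso_inv_naturality_right hp hq (hR i) (hS j) (hS j') (S.d j j'))
    (ComplexShape.up ℤ)

/-- **Twisting the first factor, as cochain complexes**: for complexes `R` of vector bundles, any `S`, and a finite locally free `N` on `X`,
`(N ⊗ •R) ⊠ S ≅ (p^*N ⊗ –)•(R ⊠ S)` (termwise `boxTensorTwistLeftIso`; `p^*N ⊗ –` is a left adjoint — the tree's `tensorSheafHomAdj` — so it
preserves the coproducts of the total complex). [cite: StacksProject, Tag 01CA and Tag 0FXX] [cite: Weibel1994, §1.2, 1.2.6] -/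
def boxTensorComplexTwistLeftIso (p : Z ⟶ X) (q : Z ⟶ Y) {N : X.Modules} (hN : IsFiniteLocallyFree N) :
    haveI : ((tensorBifunctor X).obj N).Additive := additive_tensorBifunctor_obj N
    haveI : ((tensorBifunctor Z).obj ((Scheme.Modules.pullback p).obj N)).Additive := additive_tensorBifunctor_obj _
    boxTensorComplex p q ((((tensorBifunctor X).obj N).mapHomologicalComplex (ComplexShape.up ℤ)).obj R) S ≅
      ((((tensorBifunctor Z).obj ((Scheme.Modules.pullback p).obj N)).mapHomologicalComplex (ComplexShape.up ℤ)).obj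
        (boxTensorComplex p q R S)) :=
  haveI : ((tensorBifunctor X).obj N).Additive := additive_tensorBifunctor_obj N
  haveI : ((tensorBifunctor Z).obj ((Scheme.Modules.pullback p).obj N)).Additive := additive_tensorBifunctor_obj _
  haveI := isLeftAdjoint_tensorBifunctor_obj (X := Z) ((Scheme.Modules.pullback p).obj N)
  haveI := preservesZeroMorphisms_boxTensorFunctor p q
  haveI := preservesZeroMorphisms_boxTensorFunctor_obj p q
  mapBifunctorIsoOfComponents R S ((((tensorBifunctor X).obj N).mapHomologicalComplex (ComplexShape.up ℤ)).obj R) S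
    (boxTensorFunctor p q) (boxTensorFunctor p q) ((tensorBifunctor Z).obj ((Scheme.Modules.pullback p).obj N))
    (fun i j => boxTensorTwistLeftIso p q hN (hR i) (S.X j))
    (fun i i' j => boxTensorTwistLeftIso_hom_naturality_left p q hN (hR i) (hR i') (R.d i i') (S.X j))
    (fun i j j' => boxTensorTwistLeftIso_hom_naturality_right p q hN (hR i) (S.d j j'))
    (ComplexShape.up ℤ)

/-- The associator `(p'^*N₁ ⊗ –)•((q'^*N₂ ⊗ –)•K) ≅ ((N₁ ⊠_{p',q'} N₂) ⊗ –)•K`, termwise — `Functor.mapHomologicalComplexCompIso` of the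
natural isomorphism `(q'^*N₂ ⊗ –) ⋙ (p'^*N₁ ⊗ –) ≅ ((p'^*N₁ ⊗ q'^*N₂) ⊗ –)` (inverse associator, as in `AbelianVarieties/FourierMukaiExchangeTensor`). [cite: StacksProject, Tag 01CA (Lemma 17.16.1)] [cite: Weibel1994, §2.6] -/
def boxTensorTwistCompIso (p' : Z' ⟶ X') (q' : Z' ⟶ Y') (N₁ : X'.Modules) (N₂ : Y'.Modules) (K : CochainComplex Z'.Modules ℤ) :
    haveI : ((tensorBifunctor Z').obj ((Scheme.Modules.pullback p').obj N₁)).Additive := additive_tensorBifunctor_obj _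
    haveI : ((tensorBifunctor Z').obj ((Scheme.Modules.pullback q').obj N₂)).Additive := additive_tensorBifunctor_obj _
    haveI : ((tensorBifunctor Z').obj (boxTensor p' q' N₁ N₂)).Additive := additive_tensorBifunctor_obj _
    (((tensorBifunctor Z').obj ((Scheme.Modules.pullback p').obj N₁)).mapHomologicalComplex (ComplexShape.up ℤ)).obj
        ((((tensorBifunctor Z').obj ((Scheme.Modules.pullback q').obj N₂)).mapHomologicalComplex (ComplexShape.up ℤ)).obj K) ≅
      (((tensorBifunctor Z').obj (boxTensor p' q' N₁ N₂)).mapHomologicalComplex (ComplexShape.up ℤ)).obj K :=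
  haveI : ((tensorBifunctor Z').obj ((Scheme.Modules.pullback p').obj N₁)).Additive := additive_tensorBifunctor_obj _
  haveI : ((tensorBifunctor Z').obj ((Scheme.Modules.pullback q').obj N₂)).Additive := additive_tensorBifunctor_obj _
  haveI : ((tensorBifunctor Z').obj (boxTensor p' q' N₁ N₂)).Additive := additive_tensorBifunctor_obj _
  (Functor.mapHomologicalComplexCompIso
    (NatIso.ofComponents
      (fun M => (tensorAssoc ((Scheme.Modules.pullback p').obj N₁) ((Scheme.Modules.pullback q').obj N₂) M).symm)
      (fun {M M'} f => by
        rw [Functor.comp_map, tensorBifunctor_obj_map, tensorBifunctor_obj_map, tensorBifunctor_obj_map, Iso.symm_hom,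
          Iso.symm_hom, ← cancel_epi (tensorAssoc _ _ M).hom, Iso.hom_inv_id_assoc, ← Category.assoc, ← tensorMap_id,
          ← tensorAssoc_naturality, Category.assoc, Iso.hom_inv_id, Category.comp_id]) :
      (tensorBifunctor Z').obj ((Scheme.Modules.pullback q').obj N₂) ⋙ (tensorBifunctor Z').obj ((Scheme.Modules.pullback p').obj N₁) ≅
        (tensorBifunctor Z').obj (boxTensor p' q' N₁ N₂))
    (ComplexShape.up ℤ)).app K

/-- **Both twists and the two-sided base change at once** (the form consumed by the Hodge road at `g = π₁ × π₂`): for `g ≫ p = p' ≫ u`,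
`g ≫ q = q' ≫ v`, complexes `R`, `S` of vector bundles and finite locally free `N₁` on `X'`, `N₂` on `Y'`,
`(N₁ ⊗ •u^*•R) ⊠_{p',q'} (N₂ ⊗ •v^*•S) ≅ ((N₁ ⊠_{p',q'} N₂) ⊗ –)•(g^*•(R ⊠_{p,q} S))`.
[cite: StacksProject, Tag 01CA and Tag 0FXX] [cite: Weibel1994, §1.2, 1.2.6 and §2.6] -/
def boxTensorComplexTwoSidedIso (hp : g ≫ p = p' ≫ u) (hq : g ≫ q = q' ≫ v) {N₁ : X'.Modules} {N₂ : Y'.Modules}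
    (hN₁ : IsFiniteLocallyFree N₁) (hN₂ : IsFiniteLocallyFree N₂) :
    haveI : ((tensorBifunctor X').obj N₁).Additive := additive_tensorBifunctor_obj N₁
    haveI : ((tensorBifunctor Y').obj N₂).Additive := additive_tensorBifunctor_obj N₂
    haveI : ((tensorBifunctor Z').obj (boxTensor p' q' N₁ N₂)).Additive := additive_tensorBifunctor_obj _
    boxTensorComplex p' q'
        ((((tensorBifunctor X').obj N₁).mapHomologicalComplex (ComplexShape.up ℤ)).obj
          (((Scheme.Modules.pullback u).mapHomologicalComplex (ComplexShape.up ℤ)).obj R))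
        ((((tensorBifunctor Y').obj N₂).mapHomologicalComplex (ComplexShape.up ℤ)).obj
          (((Scheme.Modules.pullback v).mapHomologicalComplex (ComplexShape.up ℤ)).obj S)) ≅
      (((tensorBifunctor Z').obj (boxTensor p' q' N₁ N₂)).mapHomologicalComplex (ComplexShape.up ℤ)).obj
        (((Scheme.Modules.pullback g).mapHomologicalComplex (ComplexShape.up ℤ)).obj (boxTensorComplex p q R S)) :=
  haveI : ((tensorBifunctor X').obj N₁).Additive := additive_tensorBifunctor_obj N₁
  haveI : ((tensorBifunctor Y').obj N₂).Additive := additive_tensorBifunctor_obj N₂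
  haveI : ((tensorBifunctor Z').obj ((Scheme.Modules.pullback p').obj N₁)).Additive := additive_tensorBifunctor_obj _
  haveI : ((tensorBifunctor Z').obj ((Scheme.Modules.pullback q').obj N₂)).Additive := additive_tensorBifunctor_obj _
  haveI : ((tensorBifunctor Z').obj (boxTensor p' q' N₁ N₂)).Additive := additive_tensorBifunctor_obj _
  boxTensorComplexTwistLeftIso (((Scheme.Modules.pullback u).mapHomologicalComplex (ComplexShape.up ℤ)).obj R)
      ((((tensorBifunctor Y').obj N₂).mapHomologicalComplex (ComplexShape.up ℤ)).obj
        (((Scheme.Modules.pullback v).mapHomologicalComplex (ComplexShape.up ℤ)).obj S))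
      (fun i => (hR i).pullback u) p' q' hN₁ ≪≫
    (((tensorBifunctor Z').obj ((Scheme.Modules.pullback p').obj N₁)).mapHomologicalComplex (ComplexShape.up ℤ)).mapIso
      (boxTensorComplexTwistIso (((Scheme.Modules.pullback u).mapHomologicalComplex (ComplexShape.up ℤ)).obj R)
          (((Scheme.Modules.pullback v).mapHomologicalComplex (ComplexShape.up ℤ)).obj S) (fun j => (hS j).pullback v) p' q' hN₂ ≪≫
        (((tensorBifunctor Z').obj ((Scheme.Modules.pullback q').obj N₂)).mapHomologicalComplex (ComplexShape.up ℤ)).mapIso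
          (pullbackBoxTensorComplexIso₂ R S hR hS hp hq)) ≪≫
    boxTensorTwistCompIso p' q' N₁ N₂ _

end Complexes

end Literature.AlgebraicGeometry.Modules

end
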